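import Summits.QuantumFields.YangMills.Theorems.BalabanUVNodesN15KingModelTorusPlaneWaves
import Summits.QuantumFields.YangMills.Theorems.BalabanUVNodesN15KingModelBoxImagesPrinted
import HarnessLib

/-!
# BalabanUVNodes ∕ N15 — THE KING-MODEL RUNG (PART Ε-f): THE TORUS-vs-INFINITE-LATTICE TWIN AND THE THERMODYNAMIC LIMIT OF KING's FREE COVARIANCE —
# `|(lapF K c m²)⁻¹(x,y) − K_∞(x̃ −̊ ỹ)| ≤ (2∕m²)·C(κ_F∕2, d)·e^{−(κ_F∕4)·min_μK_μ}` (all but the nearest image are exponentially small in the VOLUME), hence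
# `(lapF (N,…,N) c m²)⁻¹(z mod N, 0) → K_∞(z)` as `N → ∞`, and `K_∞ ≥ 0`, `|K_∞(z)| ≤ K_∞(0)`, `1∕(m²+4c(d+1)) ≤ K_∞(0) ≤ 1∕m²`
# (Track A, DAG node N15 = NE2; FAN-OUT v1.1 §N15 s3 «KING-MODEL RUNG» — the volume rate of the free covariance, companion of parts Ϲ-g′∕Ν-c's torus-vs-box twins; count-neutral)

HONEST FRAMING.  Count-neutral (cell `pub-ymgap`, seat `pub-ymgap-dag-n15-e` g40; `--supports stmt-QuantumFields-27366 --as helper` = K3⁸).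
TEMPLATE LITERATURE: C. King, Commun. Math. Phys. **102** (1986) 649–677 [King1986], (4.4) p.670, §4 p.670 l.8–13; T. Bałaban, Commun. Math. Phys. **95** (1984) 17–40
[Balaban1984PropagatorsI], p.36 l.20–23 («relating G on the torus to G on the whole lattice ηZ^d in the usual way»), p.38 (1.126); [Balaban1983RegularityDecay] (2.42)–(2.43) p.584.
Part Ε-b wrote King's torus covariance as the periodisation `Σ_{m∈ℤ^{d+1}} K_∞(w + (K_μm_μ)_μ)` of part Ε-a's free kernel.  THIS FILE separates the nearest image: with the
CENTRED representative `w₀` of `x̃ − ỹ` (`2|w₀,μ| ≤ K_μ`, pv17's `centreVec`), every other image is at sup-distance `≥ min_μK_μ∕2`, so by Ε-a's decay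
§1 ★ `le_two_mul_supNorm_translate` (the far images), ★★ **`norm_tsum_freeKerC_sub_le`** (`‖Σ_m K_∞(w₀ + Km) − K_∞(w₀)‖ ≤ (2∕m²)·periodConst(κ_F∕2) d·e^{−(κ_F∕4)L}` whenever
`L ≤ K_μ` for all `μ`; the majorant series is pv17's `B4Reflection242.periodise_majorant`); §2 ★★★ **`abs_lapF_inv_sub_freeKer_le`** — THE TORUS-vs-`ℤ^{d+1}` TWIN:
`|(lapF K c m²)⁻¹(x,y) − K_∞(w₀)| ≤ (2∕m²)·periodConst(κ_F∕2) d·e^{−(κ_F∕4)·L}` for every period vector with all `K_μ ≥ L` (`c ≥ 0`, `m² > 0`) — exponentially small in the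
VOLUME, uniformly in the sites; §3 ★★★ **`tendsto_lapF_inv_cube`** — THE THERMODYNAMIC LIMIT: for every `z ∈ ℤ^{d+1}`, `(lapF (N+1,…,N+1) c m²)⁻¹(z mod (N+1), 0) → K_∞(z)`
as `N → ∞`; §4 consequences for the infinite-volume kernel, read off the torus through the limit: ★★ **`freeKer_nonneg`** (`K_∞ ≥ 0`, from part Ϻ's `lapF_inv_nonneg`),
★★ **`abs_freeKer_le_freeKer_zero`** (`|K_∞(z)| ≤ K_∞(0)`, from Ε-e's diagonal dominance), ★★ **`freeKer_zero_le_inv_mass`** (`K_∞(0) ≤ 1∕m²`), ★★ **`inv_le_freeKer_zero`**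
(`K_∞(0) ≥ 1∕(m² + 4c(d+1))`) (Ε-e's mass bounds).

PRIOR TREE ART (used, not restated): pv17 `B4TorusKernel` (`translate`, `centreVec`, `translate_centreVec_centred`, `supNorm`, `periodConst`), `B4Reflection242.periodise_majorant`,
part Ϻ (`lapF_inv_nonneg`), parts Ε-a∕b∕e.  NOT Bałaban's covariant objects; NOT a node discharge (N15 is booked through n15-a's knit, untouched); nothing continuum-YM ∕ `ℝ⁴` ∕ OS ∕
Clay.  0 `sorry`; 2 `def` (`centredDiff`, `cubePt`).

HONEST SCOPE.  The volume rate `κ_F∕4` per site of the SHORTEST period is crude (true rate `≈ m·L_phys`); `c ≥ 0`, `m² > 0`, any `d`; the limit is taken along cubes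
`(N+1)^{d+1}` with the site difference fixed in `ℤ^{d+1}`.  Locators: [King1986] (4.4) p.670, §4 p.670 l.8–13; [Balaban1984PropagatorsI] p.36 l.20–23, p.38 (1.126);
[Balaban1983RegularityDecay] (2.43) p.584.
-/

noncomputable section

open scoped BigOperators Topology
open Finset Complex Matrix Filter

namespace Summit.QuantumFields.YangMills.BalabanUVNodes.N15KingModelRung.TorusSpectral

open Literature.MathematicalPhysics.QuantumFieldTheory.Balaban1983to89.B5Prop11Plancherel (Tor unitVec)
open Literature.MathematicalPhysics.QuantumFieldTheory.Balaban1983to89.B4ContourShift (supNorm abs_le_supNorm supNorm_nonneg)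
open Literature.MathematicalPhysics.QuantumFieldTheory.Balaban1983to89.B4TorusKernel (periodConst)
open Literature.MathematicalPhysics.QuantumFieldTheory.Balaban1983to89.B4TorusKernel.MultiPeriod (translate centreVec translate_centreVec_centred
  torusSupNorm torusSupNorm_nonneg)
open Literature.MathematicalPhysics.QuantumFieldTheory.Balaban1983to89.B4Reflection242 (periodise_majorant)
open Literature.MathematicalPhysics.QuantumFieldTheory.King1986.Torus
open Summit.QuantumFields.YangMills.BalabanUVNodes.N15KingModelRung.ProperTime (lapF_inv_nonneg)

variable {d : ℕ}

/-! ## §1 All images but the nearest are far: the tail of the periodisation -/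

section Tail

variable {P : Fin (d + 1) → ℕ} {c m2 : ℝ}

/-- ★ THE FAR IMAGES: for a centred `w₀` (`2|w₀,μ| ≤ P_μ`) and `m ≠ 0`, `|w₀ + Pm|_∞ ≥ min_μP_μ∕2 ≥ L∕2`. [folklore] -/
theorem le_two_mul_supNorm_translate {L : ℕ} (hL : ∀ i, L ≤ P i) {w₀ : Fin (d + 1) → ℤ} (hw : ∀ i, 2 * |w₀ i| ≤ P i)
    {m : Fin (d + 1) → ℤ} (hm : m ≠ 0) : (L : ℝ) ≤ 2 * supNorm (translate P w₀ m) := by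
  obtain ⟨i, hi⟩ : ∃ i, m i ≠ 0 := by
    by_contra h
    push Not at h
    exact hm (funext h)
  have h1 : (1 : ℤ) ≤ |m i| := Int.one_le_abs hi
  have hP : (0 : ℤ) ≤ P i := by positivity
  have key : (L : ℤ) ≤ 2 * |w₀ i + P i * m i| := by
    have htri : (P i : ℤ) * |m i| - |w₀ i| ≤ |w₀ i + P i * m i| := by
      have := abs_sub_abs_le_abs_sub ((P i : ℤ) * m i) (-w₀ i)
      rw [abs_mul, abs_of_nonneg hP, abs_neg, sub_neg_eq_add, add_comm] at this
      exact this
    have hPm : (P i : ℤ) ≤ (P i : ℤ) * |m i| := by nlinarith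
    have hLi : (L : ℤ) ≤ P i := by exact_mod_cast hL i
    linarith [hw i]
  have key' : ((L : ℤ) : ℝ) ≤ 2 * ((|w₀ i + P i * m i| : ℤ) : ℝ) := by exact_mod_cast key
  have hs := abs_le_supNorm (translate P w₀ m) i
  rw [Literature.MathematicalPhysics.QuantumFieldTheory.Balaban1983to89.B4TorusKernel.MultiPeriod.translate_apply] at hs
  push_cast at key' hs ⊢
  linarith

/-- ★★ **THE TAIL OF THE PERIODISATION**: for a centred `w₀`, `c ≥ 0`, `m² > 0` and all `P_μ ≥ L` (`P_μ ≥ 1`),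
`‖Σ_{m∈ℤ^{d+1}} K_∞(w₀ + Pm) − K_∞(w₀)‖ ≤ (2∕m²)·periodConst(κ_F∕2) d·e^{−(κ_F∕4)·L}` — each far image is `≤ (2∕m²)e^{−(κ_F∕2)|·|_∞}·e^{−κ_FL∕4}` and the halved-rate
majorant series is bounded by pv17's periodisation constant. [cite: Balaban1984PropagatorsI, p.36 l.20–23, p.38 (1.126); Balaban1983RegularityDecay, (2.43) p.584] -/
theorem norm_tsum_freeKerC_sub_le (hc : 0 ≤ c) (hm : 0 < m2) (hP : ∀ i, 1 ≤ P i) {L : ℕ} (hL : ∀ i, L ≤ P i)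
    {w₀ : Fin (d + 1) → ℤ} (hw : ∀ i, 2 * |w₀ i| ≤ P i) :
    ‖∑' m : Fin (d + 1) → ℤ, freeKerC c m2 (translate P w₀ m) - freeKerC c m2 w₀‖
      ≤ 2 / m2 * periodConst (kappaFree c m2 d / 2) d * Real.exp (-(kappaFree c m2 d / 4 * L)) := by
  classical
  set κ := kappaFree c m2 d with hκdef
  have hκ : 0 < κ := kappaFree_pos hc hm d
  have hM : (0 : ℝ) ≤ 2 / m2 := by positivity
  -- summability of the image series and its split at `m = 0`
  have hsum : Summable fun m : Fin (d + 1) → ℤ => freeKerC c m2 (translate P w₀ m) :=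
    (summable_freeKerC hc hm).comp_injective
      (Literature.MathematicalPhysics.QuantumFieldTheory.Balaban1983to89.B4TorusKernel.MultiPeriod.translate_injective hP w₀)
  have h0 : translate P w₀ 0 = w₀ := by funext i; simp [Literature.MathematicalPhysics.QuantumFieldTheory.Balaban1983to89.B4TorusKernel.MultiPeriod.translate_apply]
  rw [hsum.tsum_eq_add_tsum_ite 0, h0, add_sub_cancel_left]
  -- the majorant at the halved rate
  obtain ⟨hmaj, hmajle⟩ := periodise_majorant (κ := κ / 2) (M := 2 / m2) (half_pos hκ) hM hP w₀
  set g : (Fin (d + 1) → ℤ) → ℝ := fun m => Real.exp (-(κ / 4 * L)) * (2 / m2 * Real.exp (-(κ / 2 * supNorm (translate P w₀ m)))) with hg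
  have hgs : Summable g := hmaj.mul_left _
  -- termwise domination of the far images
  have hle : ∀ m : Fin (d + 1) → ℤ, ‖(if m = 0 then 0 else freeKerC c m2 (translate P w₀ m))‖ ≤ g m := by
    intro m
    simp only [hg]
    by_cases hm0 : m = 0
    · rw [if_pos hm0, norm_zero]; positivity
    · rw [if_neg hm0]
      have hfar : (L : ℝ) ≤ 2 * supNorm (translate P w₀ m) := le_two_mul_supNorm_translate hL hw hm0
      have hdec := norm_freeKerC_le (d := d) hc hm (translate P w₀ m)
      rw [← hκdef] at hdec
      refine le_trans hdec ?_
      rw [show Real.exp (-(κ / 4 * L)) * (2 / m2 * Real.exp (-(κ / 2 * supNorm (translate P w₀ m))))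
          = 2 / m2 * Real.exp (-(κ / 4 * L) + -(κ / 2 * supNorm (translate P w₀ m))) by rw [Real.exp_add]; ring]
      refine mul_le_mul_of_nonneg_left (Real.exp_le_exp.mpr ?_) hM
      nlinarith [mul_le_mul_of_nonneg_left hfar hκ.le, supNorm_nonneg (translate P w₀ m)]
  have hns : Summable fun m : Fin (d + 1) → ℤ => ‖(if m = 0 then 0 else freeKerC c m2 (translate P w₀ m))‖ :=
    Summable.of_nonneg_of_le (fun m => norm_nonneg _) hle hgs
  have hPC : 0 ≤ periodConst (κ / 2) d := by
    unfold periodConst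
    apply pow_nonneg
    apply div_nonneg (by positivity)
    have : Real.exp (-(κ / 2 / (d + 1))) < 1 := Real.exp_lt_one_iff.mpr (by
      have : 0 < κ / 2 / (d + 1) := by positivity
      linarith)
    linarith
  calc ‖∑' m : Fin (d + 1) → ℤ, (if m = 0 then 0 else freeKerC c m2 (translate P w₀ m))‖
      ≤ ∑' m : Fin (d + 1) → ℤ, ‖(if m = 0 then 0 else freeKerC c m2 (translate P w₀ m))‖ := norm_tsum_le_tsum_norm hns
    _ ≤ ∑' m : Fin (d + 1) → ℤ, g m := Summable.tsum_le_tsum hle hns hgs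
    _ = Real.exp (-(κ / 4 * L)) * ∑' m : Fin (d + 1) → ℤ, 2 / m2 * Real.exp (-(κ / 2 * supNorm (translate P w₀ m))) := tsum_mul_left
    _ ≤ Real.exp (-(κ / 4 * L)) * (2 / m2 * periodConst (κ / 2) d * Real.exp (-(κ / 2 / (d + 1) * torusSupNorm P w₀))) :=
        mul_le_mul_of_nonneg_left hmajle (Real.exp_pos _).le
    _ ≤ Real.exp (-(κ / 4 * L)) * (2 / m2 * periodConst (κ / 2) d) := by
        refine mul_le_mul_of_nonneg_left ?_ (Real.exp_pos _).le
        have h1 : Real.exp (-(κ / 2 / (d + 1) * torusSupNorm P w₀)) ≤ 1 := by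
          rw [Real.exp_le_one_iff, neg_nonpos]
          exact mul_nonneg (by positivity) (torusSupNorm_nonneg hP w₀)
        calc 2 / m2 * periodConst (κ / 2) d * Real.exp (-(κ / 2 / (d + 1) * torusSupNorm P w₀))
            ≤ 2 / m2 * periodConst (κ / 2) d * 1 := mul_le_mul_of_nonneg_left h1 (mul_nonneg hM hPC)
          _ = 2 / m2 * periodConst (κ / 2) d := mul_one _
    _ = 2 / m2 * periodConst (κ / 2) d * Real.exp (-(κ / 4 * L)) := by ring

end Tail

/-! ## §2 The torus-vs-infinite-lattice twin -/

section Twin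

variable (K : Fin (d + 1) → ℕ) [hK : ∀ μ, NeZero (K μ)] {c m2 : ℝ}

/-- THE CENTRED REPRESENTATIVE of `x̃ − ỹ`: `w₀ = x̃ − ỹ + K·centreVec`, `2|w₀,μ| ≤ K_μ` — the nearest image. [folklore] -/
def centredDiff (x y : Tor K) : Fin (d + 1) → ℤ :=
  translate K (torRepZ K x - torRepZ K y) (centreVec K (torRepZ K x - torRepZ K y))

/-- `w₀` is centred. [folklore] -/
theorem centredDiff_centred (x y : Tor K) : ∀ i, 2 * |centredDiff K x y i| ≤ K i :=
  translate_centreVec_centred (one_le_period K) _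

/-- The torus covariance read at the centred representative: `(lapF K c m²)⁻¹(x,y) = Σ_m K_∞(w₀ + Km)`. [folklore] -/
theorem lapF_inv_eq_tsum_centredDiff (hc : 0 ≤ c) (hm : 0 < m2) (x y : Tor K) :
    (((lapF K c m2)⁻¹ x y : ℝ) : ℂ) = ∑' m : Fin (d + 1) → ℤ, freeKerC c m2 (translate K (centredDiff K x y) m) := by
  rw [lapF_inv_eq_torusFreeKerC K hc hm, ← torusFreeKerC_translate K (one_le_period K) _ (centreVec K (torRepZ K x - torRepZ K y)),
    torusFreeKerC_eq_periodise K hc hm (one_le_period K)]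
  rfl

/-- ★★★ **THE TORUS-vs-`ℤ^{d+1}` TWIN FOR KING's FREE COVARIANCE**: for every period vector `K` with `K_μ ≥ L` for all `μ`, every `c ≥ 0`, `m² > 0` and all sites
`x, y`, `|(lapF K c m²)⁻¹(x,y) − K_∞(w₀)| ≤ (2∕m²)·periodConst(κ_F∕2) d·e^{−(κ_F∕4)·L}`, `w₀` the centred representative of `x̃ − ỹ` — the finite-volume covariance equals the
infinite-volume kernel up to an error EXPONENTIALLY SMALL IN THE VOLUME, uniformly in the sites. [cite: Balaban1984PropagatorsI, p.36 l.20–23, p.38 (1.126); King1986, (4.4) p.670,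
§4 p.670 l.8–13; Balaban1983RegularityDecay, (2.43) p.584] -/
theorem abs_lapF_inv_sub_freeKer_le (hc : 0 ≤ c) (hm : 0 < m2) {L : ℕ} (hL : ∀ i, L ≤ K i) (x y : Tor K) :
    |(lapF K c m2)⁻¹ x y - freeKer c m2 (centredDiff K x y)|
      ≤ 2 / m2 * periodConst (kappaFree c m2 d / 2) d * Real.exp (-(kappaFree c m2 d / 4 * L)) := by
  have h := norm_tsum_freeKerC_sub_le (P := K) hc hm (one_le_period K) hL (centredDiff_centred K x y)
  rwa [← lapF_inv_eq_tsum_centredDiff K hc hm x y, ← ofReal_freeKer, ← Complex.ofReal_sub, Complex.norm_real, Real.norm_eq_abs] at h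

end Twin

/-! ## §3 The thermodynamic limit along cubes -/

section Limit

variable {c m2 : ℝ}

/-- The site `z ∈ ℤ^{d+1}` read on the cube torus `(ℤ∕(N+1))^{d+1}`. [folklore] -/
def cubePt (N : ℕ) (z : Fin (d + 1) → ℤ) : Tor (fun _ : Fin (d + 1) => N + 1) := fun μ => ((z μ : ℤ) : ZMod (N + 1))

/-- for `2|z|_∞ < N+1` the centred representative of `z mod (N+1) − 0` is `z` itself. [folklore] -/
theorem centredDiff_cubePt_eq {N : ℕ} {z : Fin (d + 1) → ℤ} (hz : ∀ i, 2 * |z i| < (N : ℤ) + 1) :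
    centredDiff (fun _ : Fin (d + 1) => N + 1) (cubePt N z) 0 = z := by
  have hN1 : ∀ i : Fin (d + 1), 1 ≤ (fun _ : Fin (d + 1) => N + 1) i := fun _ => Nat.succ_le_succ (Nat.zero_le _)
  -- `w₀` and `z` are congruent mod `N+1` and both centred, hence equal
  have hcong : ∀ i, ((N : ℤ) + 1) ∣ centredDiff (fun _ : Fin (d + 1) => N + 1) (cubePt N z) 0 i - z i := by
    intro i
    have h1 : ((N : ℤ) + 1) ∣ (torRepZ (fun _ : Fin (d + 1) => N + 1) (cubePt N z) - torRepZ (fun _ : Fin (d + 1) => N + 1) 0) i - z i := by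
      rw [show ((N : ℤ) + 1) = ((N + 1 : ℕ) : ℤ) by push_cast; ring, ← ZMod.intCast_eq_intCast_iff_dvd_sub]
      rw [Pi.sub_apply, Int.cast_sub, intCast_torRepZ, intCast_torRepZ, Pi.zero_apply, sub_zero]
      rfl
    unfold centredDiff
    rw [Literature.MathematicalPhysics.QuantumFieldTheory.Balaban1983to89.B4TorusKernel.MultiPeriod.translate_apply]
    have e : (torRepZ (fun _ : Fin (d + 1) => N + 1) (cubePt N z) - torRepZ (fun _ : Fin (d + 1) => N + 1) 0) i
        + ((N + 1 : ℕ) : ℤ) * centreVec (fun _ : Fin (d + 1) => N + 1) (torRepZ (fun _ : Fin (d + 1) => N + 1) (cubePt N z) - torRepZ (fun _ : Fin (d + 1) => N + 1) 0) i - z i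
        = ((torRepZ (fun _ : Fin (d + 1) => N + 1) (cubePt N z) - torRepZ (fun _ : Fin (d + 1) => N + 1) 0) i - z i)
          + ((N : ℤ) + 1) * centreVec (fun _ : Fin (d + 1) => N + 1) (torRepZ (fun _ : Fin (d + 1) => N + 1) (cubePt N z) - torRepZ (fun _ : Fin (d + 1) => N + 1) 0) i := by
      push_cast; ring
    rw [e]
    exact dvd_add h1 (dvd_mul_right _ _)
  funext i
  have hc := centredDiff_centred (fun _ : Fin (d + 1) => N + 1) (cubePt N z) 0 i
  obtain ⟨k, hk⟩ := hcong i
  -- `|w₀ − z| ≤ |w₀| + |z| < N + 1`, and `N+1 ∣ w₀ − z` ⇒ `w₀ = z`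
  have hsmall : 2 * |centredDiff (fun _ : Fin (d + 1) => N + 1) (cubePt N z) 0 i - z i| < 2 * ((N : ℤ) + 1) := by
    have := abs_sub (centredDiff (fun _ : Fin (d + 1) => N + 1) (cubePt N z) 0 i) (z i)
    push_cast at hc
    linarith [hz i]
  rw [hk, abs_mul, abs_of_nonneg (by positivity : (0 : ℤ) ≤ (N : ℤ) + 1)] at hsmall
  have hk0 : k = 0 := by
    by_contra hk0
    have : (1 : ℤ) ≤ |k| := Int.one_le_abs hk0
    nlinarith
  rw [hk0, mul_zero, sub_eq_zero] at hk
  exact hk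

/-- ★★★ **THE THERMODYNAMIC LIMIT OF KING's FREE TORUS COVARIANCE**: for every `z ∈ ℤ^{d+1}`, `c ≥ 0`, `m² > 0`,
`(lapF (N+1,…,N+1) c m²)⁻¹(z mod (N+1), 0) → K_∞(z)` as `N → ∞` (the error is `O(e^{−(κ_F∕4)(N+1)})` once `2|z|_∞ < N+1`).
[cite: Balaban1984PropagatorsI, p.36 l.20–23; King1986, (4.4) p.670; Balaban1983RegularityDecay, (2.43) p.584] -/
theorem tendsto_lapF_inv_cube (hc : 0 ≤ c) (hm : 0 < m2) (z : Fin (d + 1) → ℤ) :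
    Tendsto (fun N : ℕ => (lapF (fun _ : Fin (d + 1) => N + 1) c m2)⁻¹ (cubePt N z) 0) atTop (𝓝 (freeKer c m2 z)) := by
  set C := 2 / m2 * periodConst (kappaFree c m2 d / 2) d with hC
  have hκ : 0 < kappaFree c m2 d := kappaFree_pos hc hm d
  -- the error bound, eventually
  have hev : ∀ᶠ N : ℕ in atTop, |(lapF (fun _ : Fin (d + 1) => N + 1) c m2)⁻¹ (cubePt N z) 0 - freeKer c m2 z|
      ≤ C * Real.exp (-(kappaFree c m2 d / 4 * ((N + 1 : ℕ) : ℝ))) := by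
    refine Filter.eventually_atTop.2 ⟨⌈2 * supNorm z⌉₊, fun N hN => ?_⟩
    have hz : ∀ i, 2 * |z i| < (N : ℤ) + 1 := by
      intro i
      have h1 : ((|z i| : ℤ) : ℝ) ≤ supNorm z := abs_le_supNorm z i
      have h2 : 2 * supNorm z ≤ (⌈2 * supNorm z⌉₊ : ℝ) := Nat.le_ceil _
      have h3 : ((⌈2 * supNorm z⌉₊ : ℕ) : ℝ) ≤ N := by exact_mod_cast hN
      have h4 : ((2 * |z i| : ℤ) : ℝ) < (((N : ℤ) + 1 : ℤ) : ℝ) := by push_cast at h1 ⊢; linarith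
      exact_mod_cast h4
    have h := abs_lapF_inv_sub_freeKer_le (fun _ : Fin (d + 1) => N + 1) hc hm (L := N + 1) (fun _ => le_rfl) (cubePt N z) 0
    rwa [centredDiff_cubePt_eq hz] at h
  -- squeeze
  have hlim : Tendsto (fun N : ℕ => C * Real.exp (-(kappaFree c m2 d / 4 * ((N + 1 : ℕ) : ℝ)))) atTop (𝓝 0) := by
    rw [show (0 : ℝ) = C * 0 by ring]
    refine Tendsto.const_mul C ?_
    refine Real.tendsto_exp_atBot.comp ?_
    refine tendsto_neg_atTop_atBot.comp ?_
    refine Tendsto.const_mul_atTop (by positivity) ?_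
    exact tendsto_natCast_atTop_atTop.comp (tendsto_add_atTop_nat 1)
  rw [tendsto_iff_norm_sub_tendsto_zero]
  refine squeeze_zero' (Filter.Eventually.of_forall fun N => norm_nonneg _) ?_ hlim
  filter_upwards [hev] with N hN
  rwa [Real.norm_eq_abs]

end Limit

/-! ## §4 The infinite-volume kernel inherits the torus facts -/

section Inherit

variable {c m2 : ℝ}

/-- ★★ **`K_∞ ≥ 0`** — the limit of the non-negative torus covariances (part Ϻ's inverse positivity). [cite: King1986, (4.4) p.670] -/
theorem freeKer_nonneg (hc : 0 ≤ c) (hm : 0 < m2) (z : Fin (d + 1) → ℤ) : 0 ≤ freeKer c m2 z :=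
  ge_of_tendsto' (tendsto_lapF_inv_cube (d := d) hc hm z) fun N => lapF_inv_nonneg (fun _ : Fin (d + 1) => N + 1) hc hm _ _

/-- ★★ **`K_∞(0) ≤ 1∕m²`** (Ε-e's upper mass bound on every cube). [cite: King1986, (4.4) p.670] -/
theorem freeKer_zero_le_inv_mass (hc : 0 ≤ c) (hm : 0 < m2) : freeKer c m2 (0 : Fin (d + 1) → ℤ) ≤ m2⁻¹ := by
  refine le_of_tendsto' (tendsto_lapF_inv_cube (d := d) hc hm 0) fun N => ?_
  have h0 : cubePt (d := d) N 0 = 0 := by funext μ; simp [cubePt]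
  rw [h0]
  exact lapF_inv_diag_le_inv_mass (fun _ : Fin (d + 1) => N + 1) hc hm 0

/-- ★★ **`K_∞(0) ≥ 1∕(m² + 4c(d+1))`** (Ε-e's lower mass bound on every cube). [cite: King1986, (4.4) p.670] -/
theorem inv_le_freeKer_zero (hc : 0 ≤ c) (hm : 0 < m2) : (m2 + 4 * c * (d + 1))⁻¹ ≤ freeKer c m2 (0 : Fin (d + 1) → ℤ) := by
  refine ge_of_tendsto' (tendsto_lapF_inv_cube (d := d) hc hm 0) fun N => ?_
  have h0 : cubePt (d := d) N 0 = 0 := by funext μ; simp [cubePt]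
  rw [h0]
  exact inv_le_lapF_inv_diag (fun _ : Fin (d + 1) => N + 1) hc hm 0

/-- ★★ **`|K_∞(z)| ≤ K_∞(0)`** — diagonal dominance survives the limit. [cite: King1986, (4.4) p.670] -/
theorem abs_freeKer_le_freeKer_zero (hc : 0 ≤ c) (hm : 0 < m2) (z : Fin (d + 1) → ℤ) : |freeKer c m2 z| ≤ freeKer c m2 (0 : Fin (d + 1) → ℤ) := by
  have h1 := (tendsto_lapF_inv_cube (d := d) hc hm z).abs
  have h2 := tendsto_lapF_inv_cube (d := d) hc hm 0
  have h0 : ∀ N, cubePt (d := d) N 0 = 0 := fun N => by funext μ; simp [cubePt]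
  refine le_of_tendsto_of_tendsto' h1 h2 fun N => ?_
  rw [h0]
  calc |(lapF (fun _ : Fin (d + 1) => N + 1) c m2)⁻¹ (cubePt N z) 0|
      ≤ (lapF (fun _ : Fin (d + 1) => N + 1) c m2)⁻¹ (cubePt N z) (cubePt N z) := abs_lapF_inv_le_diag (fun _ : Fin (d + 1) => N + 1) hc hm _ _
    _ = (lapF (fun _ : Fin (d + 1) => N + 1) c m2)⁻¹ 0 0 := by
        rw [lapF_inv_diag_eq (fun _ : Fin (d + 1) => N + 1) hc hm, lapF_inv_diag_eq (fun _ : Fin (d + 1) => N + 1) hc hm]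

end Inherit

end Summit.QuantumFields.YangMills.BalabanUVNodes.N15KingModelRung.TorusSpectral

end
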